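import Literature.Probability.RandomMatrixProducts.AndersonModel1DLargeDeviations
import Literature.Probability.RandomMatrixProducts.AndersonModel1DVectorLDT
import HarnessLib

/-!
# Large deviations for the Anderson transfer matrices, III: proof of Bucaj et al. Thm 3.1 (`BucajEtAl2019_matrixLDT_holds`)

Companion to `AndersonModel1D.lean` (Bucaj–Damanik–Fillman–Gerbuz–VandenBoom–Wang–Zhang,
*Localization for the one-dimensional Anderson model via positivity and large deviations for the
Lyapunov exponent*, TAMS **372** (2019) 3619–3667, arXiv:1706.06135, §3).  Everything here is
PROVED; the file discharges the named fact `BucajEtAl2019_matrixLDT` (Thm 3.1 of the source: the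
uniform large-deviation estimate for `‖M_n^E‖` on the energy window `Σ̂ = [-κ, κ]`).

The proof is the source's own (§3, "Proof of Theorem 3.1"): Thm 3.1 follows from the vectorwise
uniform LDT (Prop. 3.6 there) by comparing `‖M_n‖` with `‖M_n e₁‖`, `‖M_n e₂‖` — this reduction is
`BucajEtAl2019_matrixLDT_of_vectorLDT` of `AndersonModel1DLargeDeviations.lean` — and Prop. 3.6 is
`BucajEtAl2019_vectorLDT_holds` of `AndersonModel1DVectorLDT.lean` (stationary measures on the
circle, Fürstenberg's formula, uniform one-scale bounds, and the block argument
`vectorLDT_of_uniformScale` of `AndersonModel1DLDT.lean`; an alternative block/Hoeffding route from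
locally uniform block means is `BucajEtAl2019_matrixLDT_of_localBlockMeans` of
`AndersonModel1DConcentration.lean`).  This file only assembles the two.
-/

noncomputable section

open MeasureTheory Set
open scoped ENNReal

namespace Literature.Probability.RandomMatrixProducts

/-- **Bucaj–Damanik–Fillman–Gerbuz–VandenBoom–Wang–Zhang, Thm 3.1 (uniform large deviations for
`‖M_n^E‖`), discharged**: if the single-site law `μ` has compact support with at least two points,
then for every `ε > 0` there are `C = C(ε) > 0`, `η = η(ε) > 0` with
`μ^{⊗n}{ω : |n⁻¹ log ‖M_n^E(ω)‖ - L(E)| ≥ ε} ≤ C e^{-η n}` for all `n ≥ 1` and all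
`E ∈ Σ̂ = [-κ, κ]`.  Proof as in the source: Prop. 3.6 (`BucajEtAl2019_vectorLDT_holds`) and the
half-page reduction `BucajEtAl2019_matrixLDT_of_vectorLDT`.
[cite: BucajEtAl2019, Thm 3.1 (proof: §3, "Proof of Theorem 3.1", from Prop. 3.6)] -/
theorem BucajEtAl2019_matrixLDT_holds : BucajEtAl2019_matrixLDT :=
  BucajEtAl2019_matrixLDT_of_vectorLDT BucajEtAl2019_vectorLDT_holds

/-- Thm 3.1 of Bucaj et al. in applied form: the uniform large-deviation bound for the matrix norms
`‖M_n^E‖`, `E ∈ Σ̂ = [-κ, κ]`, `n ≥ 1`. [cite: BucajEtAl2019, Thm 3.1] -/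
theorem measure_andersonMatrixLDSet_le (μ : Measure ℝ) [IsProbabilityMeasure μ]
    (hc : IsCompact μ.support) (hnt : μ.support.Nontrivial) {ε : ℝ} (hε : 0 < ε) :
    ∃ C η : ℝ, 0 < C ∧ 0 < η ∧ ∀ n : ℕ, 1 ≤ n →
      ∀ E ∈ Icc (-andersonKappa μ) (andersonKappa μ),
        (Measure.pi fun _ : Fin n => μ) (andersonMatrixLDSet μ E ε n) ≤
          ENNReal.ofReal (C * Real.exp (-(η * n))) :=
  BucajEtAl2019_matrixLDT_holds μ hc hnt ε hε

/-- Thm 3.1 and Prop. 3.6 of Bucaj et al. with COMMON constants: for every `ε > 0` one pair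
`C, η > 0` serves the matrix-norm deviation event and the vectorwise deviation events of all unit
vectors simultaneously, uniformly in `n ≥ 1` and `E ∈ Σ̂`. [cite: BucajEtAl2019, Thm 3.1 & Prop. 3.6] -/
theorem measure_andersonLDSets_le (μ : Measure ℝ) [IsProbabilityMeasure μ]
    (hc : IsCompact μ.support) (hnt : μ.support.Nontrivial) {ε : ℝ} (hε : 0 < ε) :
    ∃ C η : ℝ, 0 < C ∧ 0 < η ∧ ∀ n : ℕ, 1 ≤ n →
      ∀ E ∈ Icc (-andersonKappa μ) (andersonKappa μ),
        (Measure.pi fun _ : Fin n => μ) (andersonMatrixLDSet μ E ε n) ≤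
            ENNReal.ofReal (C * Real.exp (-(η * n))) ∧
          ∀ v : EuclideanSpace ℝ (Fin 2), ‖v‖ = 1 →
            (Measure.pi fun _ : Fin n => μ) (andersonVectorLDSet μ E ε n v) ≤
              ENNReal.ofReal (C * Real.exp (-(η * n))) := by
  obtain ⟨C₁, η₁, hC₁, hη₁, h₁⟩ := BucajEtAl2019_matrixLDT_holds μ hc hnt ε hε
  obtain ⟨C₂, η₂, hC₂, hη₂, h₂⟩ := BucajEtAl2019_vectorLDT_holds μ hc hnt ε hε
  refine ⟨max C₁ C₂, min η₁ η₂, lt_max_of_lt_left hC₁, lt_min hη₁ hη₂, fun n hn E hE => ⟨?_, ?_⟩⟩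
  · refine (h₁ n hn E hE).trans (ENNReal.ofReal_le_ofReal ?_)
    have hn' : (0 : ℝ) ≤ n := Nat.cast_nonneg n
    have hexp : Real.exp (-(η₁ * n)) ≤ Real.exp (-(min η₁ η₂ * n)) :=
      Real.exp_le_exp.mpr (by nlinarith [min_le_left η₁ η₂])
    calc C₁ * Real.exp (-(η₁ * n)) ≤ C₁ * Real.exp (-(min η₁ η₂ * n)) :=
          mul_le_mul_of_nonneg_left hexp hC₁.le
      _ ≤ max C₁ C₂ * Real.exp (-(min η₁ η₂ * n)) :=
          mul_le_mul_of_nonneg_right (le_max_left _ _) (Real.exp_pos _).le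
  · intro v hv
    refine (h₂ n hn v hv E hE).trans (ENNReal.ofReal_le_ofReal ?_)
    have hn' : (0 : ℝ) ≤ n := Nat.cast_nonneg n
    have hexp : Real.exp (-(η₂ * n)) ≤ Real.exp (-(min η₁ η₂ * n)) :=
      Real.exp_le_exp.mpr (by nlinarith [min_le_right η₁ η₂])
    calc C₂ * Real.exp (-(η₂ * n)) ≤ C₂ * Real.exp (-(min η₁ η₂ * n)) :=
          mul_le_mul_of_nonneg_left hexp hC₂.le
      _ ≤ max C₁ C₂ * Real.exp (-(min η₁ η₂ * n)) :=
          mul_le_mul_of_nonneg_right (le_max_right _ _) (Real.exp_pos _).le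

end Literature.Probability.RandomMatrixProducts

end
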